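import Summits.AtomisticToContinuum.FouriersLaw.Theses.LocalOhmBV
import Summits.AtomisticToContinuum.FouriersLaw.Theses.TransferKernelPositivity

/-!
# Crux `BVProfile` (item stmt-AtomisticToContinuum-12012), line `registered`: the finite-sum seam

`LocalOhmBV.BVProfile` (shared verbatim with `TransferKernelPositivity.BVProfile`) asks for an `N`-uniform bound on
the total variation `Σ_bonds |θ_N(i+1) − θ_N(i)|` of the linear-response kinetic-temperature profile of the pinned
anharmonic chain. The line `registered` (skeleton `Cruxes/BVProfile/Lines/birth.lean`) composes the crux from two
registered stubs:

* SUP BOUND (`stub_profileBound`): `|t| ≤ B` for every limit `t` of a profile difference quotient, all `N`, `i`;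
* BOUNDED BACKFLOW (`stub_boundedBackflow`): `Σ_{bulk bonds, ℓ ≤ i, i+1+ℓ < N} (θ_N(i+1) − θ_N(i))⁺ ≤ K`, all `N`.

This file is the sorry-free SEAM: the implication
`(sup-bound statement) → (bounded-backflow statement) → (BVProfile statement)` with
`C = 2·max K 0 + 2·max B 0·(2ℓ+1)` (`bvProfile_of_sup_of_backflow`), whose conclusion is the crux's definiens
verbatim, plus the corollaries at the two route names. Combinatorial heart (`tv_le_of_sup_of_backflow`): on a bulk
bond `|Δ| = 2Δ⁺ − Δ`, the bulk increments telescope to `θ(ℓ) − θ(N−1−ℓ)`, `|·| ≤ 2B`, and the `≤ 2ℓ` boundary bonds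
cost `≤ 2B` each. [folklore; the two-sided quantitative form of `TransferKernelPositivity.TPGlue`]
-/

noncomputable section

open Finset

namespace Summit.AtomisticToContinuum.FouriersLaw.Theorems.BVProfileSeam

/-! ## Reindexing the route's `Fin N` double sums -/

/-- Inner indicator sum over `range N`: a single term. -/
theorem sum_range_ite_eq_and (N c : ℕ) (Q : Prop) [Decidable Q] (G : ℕ → ℝ) :
    (∑ b ∈ range N, (if b = c ∧ Q then G b else 0)) = if c < N ∧ Q then G c else 0 := by
  by_cases hQ : Q
  · by_cases hc : c < N <;> simp [hQ, hc, Finset.sum_ite_eq', Finset.mem_range]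
  · simp [hQ]

/-- The route's total-variation double sum `Σ_i Σ_j [j = i+1] |θ j − θ i|`, reindexed over `range (N - 1)` for
any extension `g : ℕ → ℝ` of `θ`. -/
theorem tv_sum_eq {N : ℕ} (θ : Fin N → ℝ) (g : ℕ → ℝ) (hg : ∀ i : Fin N, g i.val = θ i) :
    (∑ i : Fin N, ∑ j : Fin N, (if j.val = i.val + 1 then |θ j - θ i| else 0)) =
      ∑ k ∈ range (N - 1), |g (k + 1) - g k| := by
  have h1 : (∑ i : Fin N, ∑ j : Fin N, (if j.val = i.val + 1 then |θ j - θ i| else 0)) =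
      ∑ i : Fin N, ∑ j : Fin N, (if j.val = i.val + 1 then |g j.val - g i.val| else 0) := by
    refine Finset.sum_congr rfl fun i _ => Finset.sum_congr rfl fun j _ => ?_
    rw [hg, hg]
  have h2 : (∑ a ∈ range N, ∑ b ∈ range N, (if b = a + 1 then |g b - g a| else 0)) =
      ∑ i : Fin N, ∑ j : Fin N, (if j.val = i.val + 1 then |g j.val - g i.val| else 0) := by
    simp only [Finset.sum_range]
  have h3 : ∀ a : ℕ, (∑ b ∈ range N, (if b = a + 1 then |g b - g a| else 0)) =
      if a + 1 < N then |g (a + 1) - g a| else 0 := by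
    intro a
    by_cases ha : a + 1 < N <;> simp [ha, Finset.sum_ite_eq', Finset.mem_range]
  have h4 : (∑ a ∈ range N, (if a + 1 < N then |g (a + 1) - g a| else 0)) =
      ∑ k ∈ range (N - 1), |g (k + 1) - g k| := by
    rw [← Finset.sum_filter]
    refine Finset.sum_congr ?_ fun _ _ => rfl
    ext a
    simp only [Finset.mem_filter, Finset.mem_range]
    omega
  rw [h1, ← h2, Finset.sum_congr rfl fun a _ => h3 a, h4]

/-- The bulk backflow double sum of `stub_boundedBackflow`, reindexed over `Ico ℓ (N - 1 - ℓ)` for any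
extension `g : ℕ → ℝ` of `θ`. -/
theorem backflow_sum_eq {N : ℕ} (θ : Fin N → ℝ) (g : ℕ → ℝ) (hg : ∀ i : Fin N, g i.val = θ i) (ℓ : ℕ) :
    (∑ i : Fin N, ∑ j : Fin N,
        (if j.val = i.val + 1 ∧ ℓ ≤ i.val ∧ i.val + 1 + ℓ < N then max (θ j - θ i) 0 else 0)) =
      ∑ k ∈ Ico ℓ (N - 1 - ℓ), max (g (k + 1) - g k) 0 := by
  have h1 : (∑ i : Fin N, ∑ j : Fin N,
        (if j.val = i.val + 1 ∧ ℓ ≤ i.val ∧ i.val + 1 + ℓ < N then max (θ j - θ i) 0 else 0)) =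
      ∑ i : Fin N, ∑ j : Fin N,
        (if j.val = i.val + 1 ∧ ℓ ≤ i.val ∧ i.val + 1 + ℓ < N then
          max (g j.val - g i.val) 0 else 0) := by
    refine Finset.sum_congr rfl fun i _ => Finset.sum_congr rfl fun j _ => ?_
    rw [hg, hg]
  have h2 : (∑ a ∈ range N, ∑ b ∈ range N,
        (if b = a + 1 ∧ ℓ ≤ a ∧ a + 1 + ℓ < N then max (g b - g a) 0 else 0)) =
      ∑ i : Fin N, ∑ j : Fin N,
        (if j.val = i.val + 1 ∧ ℓ ≤ i.val ∧ i.val + 1 + ℓ < N then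
          max (g j.val - g i.val) 0 else 0) := by
    simp only [Finset.sum_range]
  have h3 : ∀ a : ℕ, (∑ b ∈ range N,
        (if b = a + 1 ∧ ℓ ≤ a ∧ a + 1 + ℓ < N then max (g b - g a) 0 else 0)) =
      if a + 1 < N ∧ (ℓ ≤ a ∧ a + 1 + ℓ < N) then max (g (a + 1) - g a) 0 else 0 := fun a =>
    sum_range_ite_eq_and N (a + 1) (ℓ ≤ a ∧ a + 1 + ℓ < N) (fun b => max (g b - g a) 0)
  have h4 : (∑ a ∈ range N, (if a + 1 < N ∧ (ℓ ≤ a ∧ a + 1 + ℓ < N) then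
        max (g (a + 1) - g a) 0 else 0)) =
      ∑ k ∈ Ico ℓ (N - 1 - ℓ), max (g (k + 1) - g k) 0 := by
    rw [← Finset.sum_filter]
    refine Finset.sum_congr ?_ fun _ _ => rfl
    ext a
    simp only [Finset.mem_filter, Finset.mem_range, Finset.mem_Ico]
    omega
  rw [h1, ← h2, Finset.sum_congr rfl fun a _ => h3 a, h4]

/-! ## The combinatorial heart -/

/-- Telescoping of increments: `Σ_{k<m} (g(a+k+1) − g(a+k)) = g(a+m) − g(a)`. -/
theorem telescope (g : ℕ → ℝ) (a m : ℕ) :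
    (∑ k ∈ range m, (g (a + k + 1) - g (a + k))) = g (a + m) - g a := by
  induction m with
  | zero => simp
  | succ m ih =>
    rw [Finset.sum_range_succ, ih, show a + (m + 1) = a + m + 1 from rfl]
    ring

/-- **The combinatorial heart of the line.** If `|g| ≤ B` pointwise and the positive parts of the increments of
`g` over the bulk window `Ico ℓ (n - ℓ)` sum to at most `K`, then the total variation of `g` over `range n` is
at most `2K + 2B(2ℓ+1)`: on the bulk `|Δ| = 2Δ⁺ − Δ` and `Σ Δ` telescopes (`|g(n−ℓ) − g(ℓ)| ≤ 2B`); the `≤ 2ℓ`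
remaining increments are `≤ 2B` each. [folklore] -/
theorem tv_le_of_sup_of_backflow (g : ℕ → ℝ) (n ℓ : ℕ) (B K : ℝ)
    (hB : ∀ k, |g k| ≤ B)
    (hK : (∑ k ∈ Ico ℓ (n - ℓ), max (g (k + 1) - g k) 0) ≤ K) :
    (∑ k ∈ range n, |g (k + 1) - g k|) ≤ 2 * K + 2 * B * (2 * ℓ + 1) := by
  have hB0 : 0 ≤ B := le_trans (abs_nonneg _) (hB 0)
  have hd : ∀ a b, |g a - g b| ≤ 2 * B := fun a b =>
    calc |g a - g b| ≤ |g a| + |g b| := abs_sub _ _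
      _ ≤ B + B := add_le_add (hB a) (hB b)
      _ = 2 * B := by ring
  have hedge : ∀ s : Finset ℕ, (∑ k ∈ s, |g (k + 1) - g k|) ≤ (s.card : ℝ) * (2 * B) := by
    intro s
    have h := Finset.sum_le_card_nsmul s (fun k => |g (k + 1) - g k|) (2 * B) (fun k _ => hd _ _)
    simpa [nsmul_eq_mul] using h
  by_cases hℓ : ℓ ≤ n - ℓ
  · have hn : n - ℓ ≤ n := Nat.sub_le n ℓ
    have hsplit : (∑ k ∈ range n, |g (k + 1) - g k|) =
        (∑ k ∈ Ico 0 ℓ, |g (k + 1) - g k|) + (∑ k ∈ Ico ℓ (n - ℓ), |g (k + 1) - g k|)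
          + ∑ k ∈ Ico (n - ℓ) n, |g (k + 1) - g k| := by
      rw [Finset.range_eq_Ico, ← Finset.sum_Ico_consecutive _ (Nat.zero_le (n - ℓ)) hn,
        ← Finset.sum_Ico_consecutive _ (Nat.zero_le ℓ) hℓ]
    have h1 : (∑ k ∈ Ico 0 ℓ, |g (k + 1) - g k|) ≤ (ℓ : ℝ) * (2 * B) := by
      have h := hedge (Ico 0 ℓ)
      have hc : ((Ico 0 ℓ).card : ℝ) = ℓ := by
        rw [Nat.card_Ico]; norm_cast
      rw [hc] at h
      exact h
    have h3 : (∑ k ∈ Ico (n - ℓ) n, |g (k + 1) - g k|) ≤ (ℓ : ℝ) * (2 * B) := by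
      have h := hedge (Ico (n - ℓ) n)
      have hc : ((Ico (n - ℓ) n).card : ℝ) = ℓ := by
        rw [Nat.card_Ico]; norm_cast; omega
      rw [hc] at h
      exact h
    have h2 : (∑ k ∈ Ico ℓ (n - ℓ), |g (k + 1) - g k|) ≤ 2 * K + 2 * B := by
      have hid : (∑ k ∈ Ico ℓ (n - ℓ), |g (k + 1) - g k|) =
          2 * (∑ k ∈ Ico ℓ (n - ℓ), max (g (k + 1) - g k) 0)
            - ∑ k ∈ Ico ℓ (n - ℓ), (g (k + 1) - g k) := by
        have habs : ∀ x : ℝ, |x| = 2 * max x 0 - x := fun x => by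
          rcases le_total 0 x with h | h
          · rw [abs_of_nonneg h, max_eq_left h]; ring
          · rw [abs_of_nonpos h, max_eq_right h]; ring
        rw [Finset.mul_sum, ← Finset.sum_sub_distrib]
        exact Finset.sum_congr rfl fun k _ => by rw [habs]
      have htel : (∑ k ∈ Ico ℓ (n - ℓ), (g (k + 1) - g k)) = g (n - ℓ) - g ℓ := by
        rw [Finset.sum_Ico_eq_sum_range]
        have h := telescope g ℓ (n - ℓ - ℓ)
        rw [show ℓ + (n - ℓ - ℓ) = n - ℓ by omega] at h
        exact h
      rw [hid, htel]
      have hab := abs_le.mp (hd ℓ (n - ℓ))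
      linarith [hab.1, hab.2, hK]
    rw [hsplit]
    have he : (ℓ : ℝ) * (2 * B) + (2 * K + 2 * B) + (ℓ : ℝ) * (2 * B) =
        2 * K + 2 * B * (2 * ℓ + 1) := by ring
    linarith [h1, h2, h3, he]
  · rw [not_le] at hℓ
    have hK0 : 0 ≤ K := by
      rw [Finset.Ico_eq_empty_of_le hℓ.le, Finset.sum_empty] at hK
      exact hK
    have hn : (n : ℝ) ≤ 2 * ℓ := by norm_cast; omega
    have h := hedge (range n)
    rw [Finset.card_range] at h
    have h5 : (n : ℝ) * (2 * B) ≤ (2 * ℓ) * (2 * B) :=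
      mul_le_mul_of_nonneg_right hn (by linarith)
    nlinarith [h, h5, hB0, hK0]

end Summit.AtomisticToContinuum.FouriersLaw.Theorems.BVProfileSeam

namespace Summit.AtomisticToContinuum.FouriersLaw.Theorems

open BVProfileSeam

/-! ## The seam -/

/-- **The seam of line `registered`, sorry-free** (axioms `propext`, `Classical.choice`, `Quot.sound`):
(statement of `stub_profileBound`) → (statement of `stub_boundedBackflow`) → (statement of `LocalOhmBV.BVProfile`,
its definiens VERBATIM), with `C = 2·max K 0 + 2·max B 0·(2ℓ+1)`: zero-extend the profile, bound it by `max B 0`,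
reindex both double sums and apply `tv_le_of_sup_of_backflow` on `range (N − 1)`. No definitions. [folklore] -/
theorem bvProfile_of_sup_of_backflow :
    (∀ ω₂ lam β γ : ℝ, 0 < ω₂ → 0 < lam → 0 < β → 0 < γ → (∀ (N : ℕ) (T_L T_R : ℝ), 0 < T_L → 0 < T_R → ∀ μ ν : MeasureTheory.Measure (Literature.MathematicalPhysics.KineticTheory.HeatConduction.PhaseSpace N), (Literature.MathematicalPhysics.KineticTheory.HeatConduction.pinnedChain ω₂ lam β γ).IsSteadyState N T_L T_R μ → (Literature.MathematicalPhysics.KineticTheory.HeatConduction.pinnedChain ω₂ lam β γ).IsSteadyState N T_L T_R ν → μ = ν) → ∀ μ : (N : ℕ) → ℝ → ℝ → MeasureTheory.Measure (Literature.MathematicalPhysics.KineticTheory.HeatConduction.PhaseSpace N), (∀ (N : ℕ) (T_L T_R : ℝ), 0 < T_L → 0 < T_R → (Literature.MathematicalPhysics.KineticTheory.HeatConduction.pinnedChain ω₂ lam β γ).IsSteadyState N T_L T_R (μ N T_L T_R)) → ∀ T : ℝ, 0 < T → ∃ B : ℝ, ∀ (N : ℕ) (i : Fin N) (t : ℝ),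 Filter.Tendsto (fun δ : ℝ => ((∫ x, (x.2 i) ^ 2 ∂(μ N (T + δ / 2) (T - δ / 2))) - ∫ x, (x.2 i) ^ 2 ∂(μ N T T)) / δ) (nhdsWithin 0 {(0 : ℝ)}ᶜ) (nhds t) → |t| ≤ B) →
    (∀ ω₂ lam β γ : ℝ, 0 < ω₂ → 0 < lam → 0 < β → 0 < γ → (∀ (N : ℕ) (T_L T_R : ℝ), 0 < T_L → 0 < T_R → ∀ μ ν : MeasureTheory.Measure (Literature.MathematicalPhysics.KineticTheory.HeatConduction.PhaseSpace N), (Literature.MathematicalPhysics.KineticTheory.HeatConduction.pinnedChain ω₂ lam β γ).IsSteadyState N T_L T_R μ → (Literature.MathematicalPhysics.KineticTheory.HeatConduction.pinnedChain ω₂ lam β γ).IsSteadyState N T_L T_R ν → μ = ν) → ∀ μ : (N : ℕ) → ℝ → ℝ → MeasureTheory.Measure (Literature.MathematicalPhysics.KineticTheory.HeatConduction.PhaseSpace N), (∀ (N : ℕ) (T_L T_R : ℝ), 0 < T_L → 0 < T_R → (Literature.MathematicalPhysics.KineticTheory.HeatConduction.pinnedChain ω₂ lam β γ).IsSteadyState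 N T_L T_R (μ N T_L T_R)) → ∀ T : ℝ, 0 < T → ∃ (ℓ : ℕ) (K : ℝ), ∀ (N : ℕ) (θ : Fin N → ℝ), (∀ i : Fin N, Filter.Tendsto (fun δ : ℝ => ((∫ x, (x.2 i) ^ 2 ∂(μ N (T + δ / 2) (T - δ / 2))) - ∫ x, (x.2 i) ^ 2 ∂(μ N T T)) / δ) (nhdsWithin 0 {(0 : ℝ)}ᶜ) (nhds (θ i))) → ∑ i : Fin N, ∑ j : Fin N, (if j.val = i.val + 1 ∧ ℓ ≤ i.val ∧ i.val + 1 + ℓ < N then max (θ j - θ i) 0 else 0) ≤ K) →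
    (∀ ω₂ lam β γ : ℝ, 0 < ω₂ → 0 < lam → 0 < β → 0 < γ → (∀ (N : ℕ) (T_L T_R : ℝ), 0 < T_L → 0 < T_R → ∀ μ ν : MeasureTheory.Measure (Literature.MathematicalPhysics.KineticTheory.HeatConduction.PhaseSpace N), (Literature.MathematicalPhysics.KineticTheory.HeatConduction.pinnedChain ω₂ lam β γ).IsSteadyState N T_L T_R μ → (Literature.MathematicalPhysics.KineticTheory.HeatConduction.pinnedChain ω₂ lam β γ).IsSteadyState N T_L T_R ν → μ = ν) → ∀ μ : (N : ℕ) → ℝ → ℝ → MeasureTheory.Measure (Literature.MathematicalPhysics.KineticTheory.HeatConduction.PhaseSpace N), (∀ (N : ℕ) (T_L T_R : ℝ), 0 < T_L → 0 < T_R → (Literature.MathematicalPhysics.KineticTheory.HeatConduction.pinnedChain ω₂ lam β γ).IsSteadyState N T_L T_R (μ N T_L T_R)) → ∀ T : ℝ, 0 < T → ∃ C : ℝ, ∀ (N : ℕ) (θ : Fin N → ℝ), (∀ i : Fin N, Filter.Tendsto (fun δ : ℝ => ((∫ x, (x.2 i) ^ 2 ∂(μ N (T + δ / 2) (T - δ /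 2))) - ∫ x, (x.2 i) ^ 2 ∂(μ N T T)) / δ) (nhdsWithin 0 {(0 : ℝ)}ᶜ) (nhds (θ i))) → ∑ i : Fin N, ∑ j : Fin N, (if j.val = i.val + 1 then |θ j - θ i| else 0) ≤ C) := by
  intro hPB hBF ω₂ lam β γ hω hl hβ hγ hU μ hμ T hT
  obtain ⟨B, hB⟩ := hPB ω₂ lam β γ hω hl hβ hγ hU μ hμ T hT
  obtain ⟨ℓ, K, hK⟩ := hBF ω₂ lam β γ hω hl hβ hγ hU μ hμ T hT
  refine ⟨2 * max K 0 + 2 * max B 0 * (2 * ℓ + 1), fun N θ hθ => ?_⟩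
  -- the zero extension of the profile and its sup bound
  set g : ℕ → ℝ := fun k => if h : k < N then θ ⟨k, h⟩ else 0 with hg_def
  have hg : ∀ i : Fin N, g i.val = θ i := fun i => by simp [hg_def, i.isLt]
  have hgB : ∀ k, |g k| ≤ max B 0 := by
    intro k
    by_cases hk : k < N
    · rw [hg ⟨k, hk⟩]
      exact (hB N ⟨k, hk⟩ (θ ⟨k, hk⟩) (hθ ⟨k, hk⟩)).trans (le_max_left _ _)
    · have h0 : g k = 0 := by simp [hg_def, hk]
      rw [h0, abs_zero]
      exact le_max_right _ _
  -- bulk backflow bound, reindexed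
  have hKg : (∑ k ∈ Ico ℓ (N - 1 - ℓ), max (g (k + 1) - g k) 0) ≤ max K 0 := by
    rw [← backflow_sum_eq θ g hg ℓ]
    exact (hK N θ hθ).trans (le_max_left _ _)
  -- total variation, reindexed, and the combinatorial heart
  rw [tv_sum_eq θ g hg]
  exact tv_le_of_sup_of_backflow g (N - 1) ℓ (max B 0) (max K 0) hgB hKg

/-- **The seam at the crux's name in route `LocalOhmBV`**: (sup-bound statement) → (bounded-backflow statement) →
`LocalOhmBV.BVProfile`. [folklore] -/
theorem localOhmBV_bvProfile_of_sup_of_backflow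
    (hPB : ∀ ω₂ lam β γ : ℝ, 0 < ω₂ → 0 < lam → 0 < β → 0 < γ → (∀ (N : ℕ) (T_L T_R : ℝ), 0 < T_L → 0 < T_R → ∀ μ ν : MeasureTheory.Measure (Literature.MathematicalPhysics.KineticTheory.HeatConduction.PhaseSpace N), (Literature.MathematicalPhysics.KineticTheory.HeatConduction.pinnedChain ω₂ lam β γ).IsSteadyState N T_L T_R μ → (Literature.MathematicalPhysics.KineticTheory.HeatConduction.pinnedChain ω₂ lam β γ).IsSteadyState N T_L T_R ν → μ = ν) → ∀ μ : (N : ℕ) → ℝ → ℝ → MeasureTheory.Measure (Literature.MathematicalPhysics.KineticTheory.HeatConduction.PhaseSpace N), (∀ (N : ℕ) (T_L T_R : ℝ), 0 < T_L → 0 < T_R → (Literature.MathematicalPhysics.KineticTheory.HeatConduction.pinnedChain ω₂ lam β γ).IsSteadyState N T_L T_R (μ N T_L T_R)) → ∀ T : ℝ, 0 < T → ∃ B : ℝ, ∀ (N : ℕ) (i : Fin N) (t : ℝ), Filter.Tendsto (fun δ : ℝ => ((∫ x, (x.2 i) ^ 2 ∂(μ N (T + δ / 2) (T - δ / 2)))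 - ∫ x, (x.2 i) ^ 2 ∂(μ N T T)) / δ) (nhdsWithin 0 {(0 : ℝ)}ᶜ) (nhds t) → |t| ≤ B)
    (hBF : ∀ ω₂ lam β γ : ℝ, 0 < ω₂ → 0 < lam → 0 < β → 0 < γ → (∀ (N : ℕ) (T_L T_R : ℝ), 0 < T_L → 0 < T_R → ∀ μ ν : MeasureTheory.Measure (Literature.MathematicalPhysics.KineticTheory.HeatConduction.PhaseSpace N), (Literature.MathematicalPhysics.KineticTheory.HeatConduction.pinnedChain ω₂ lam β γ).IsSteadyState N T_L T_R μ → (Literature.MathematicalPhysics.KineticTheory.HeatConduction.pinnedChain ω₂ lam β γ).IsSteadyState N T_L T_R ν → μ = ν) → ∀ μ : (N : ℕ) → ℝ → ℝ → MeasureTheory.Measure (Literature.MathematicalPhysics.KineticTheory.HeatConduction.PhaseSpace N), (∀ (N : ℕ) (T_L T_R : ℝ), 0 < T_L → 0 < T_R → (Literature.MathematicalPhysics.KineticTheory.HeatConduction.pinnedChain ω₂ lam β γ).IsSteadyState N T_L T_R (μ N T_L T_R)) → ∀ T : ℝ, 0 < T → ∃ (ℓ : ℕ) (K : ℝ), ∀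 (N : ℕ) (θ : Fin N → ℝ), (∀ i : Fin N, Filter.Tendsto (fun δ : ℝ => ((∫ x, (x.2 i) ^ 2 ∂(μ N (T + δ / 2) (T - δ / 2))) - ∫ x, (x.2 i) ^ 2 ∂(μ N T T)) / δ) (nhdsWithin 0 {(0 : ℝ)}ᶜ) (nhds (θ i))) → ∑ i : Fin N, ∑ j : Fin N, (if j.val = i.val + 1 ∧ ℓ ≤ i.val ∧ i.val + 1 + ℓ < N then max (θ j - θ i) 0 else 0) ≤ K) :
    _root_.Summit.AtomisticToContinuum.FouriersLaw.Theses.LocalOhmBV.BVProfile :=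
  bvProfile_of_sup_of_backflow hPB hBF

/-- **The seam at the crux's name in the sister route `TransferKernelPositivity`** (the shared item's second name;
the two route decls have identical bodies). [folklore] -/
theorem transferKernelPositivity_bvProfile_of_sup_of_backflow
    (hPB : ∀ ω₂ lam β γ : ℝ, 0 < ω₂ → 0 < lam → 0 < β → 0 < γ → (∀ (N : ℕ) (T_L T_R : ℝ), 0 < T_L → 0 < T_R → ∀ μ ν : MeasureTheory.Measure (Literature.MathematicalPhysics.KineticTheory.HeatConduction.PhaseSpace N), (Literature.MathematicalPhysics.KineticTheory.HeatConduction.pinnedChain ω₂ lam β γ).IsSteadyState N T_L T_R μ → (Literature.MathematicalPhysics.KineticTheory.HeatConduction.pinnedChain ω₂ lam β γ).IsSteadyState N T_L T_R ν → μ = ν) → ∀ μ : (N : ℕ) → ℝ → ℝ → MeasureTheory.Measure (Literature.MathematicalPhysics.KineticTheory.HeatConduction.PhaseSpace N), (∀ (N : ℕ) (T_L T_R : ℝ), 0 < T_L → 0 < T_R → (Literature.MathematicalPhysics.KineticTheory.HeatConduction.pinnedChain ω₂ lam β γ).IsSteadyState N T_L T_R (μ N T_L T_R)) → ∀ T : ℝ,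 0 < T → ∃ B : ℝ, ∀ (N : ℕ) (i : Fin N) (t : ℝ), Filter.Tendsto (fun δ : ℝ => ((∫ x, (x.2 i) ^ 2 ∂(μ N (T + δ / 2) (T - δ / 2))) - ∫ x, (x.2 i) ^ 2 ∂(μ N T T)) / δ) (nhdsWithin 0 {(0 : ℝ)}ᶜ) (nhds t) → |t| ≤ B)
    (hBF : ∀ ω₂ lam β γ : ℝ, 0 < ω₂ → 0 < lam → 0 < β → 0 < γ → (∀ (N : ℕ) (T_L T_R : ℝ), 0 < T_L → 0 < T_R → ∀ μ ν : MeasureTheory.Measure (Literature.MathematicalPhysics.KineticTheory.HeatConduction.PhaseSpace N), (Literature.MathematicalPhysics.KineticTheory.HeatConduction.pinnedChain ω₂ lam β γ).IsSteadyState N T_L T_R μ → (Literature.MathematicalPhysics.KineticTheory.HeatConduction.pinnedChain ω₂ lam β γ).IsSteadyState N T_L T_R ν → μ = ν) → ∀ μ : (N : ℕ) → ℝ → ℝ → MeasureTheory.Measure (Literature.MathematicalPhysics.KineticTheory.HeatConduction.PhaseSpace N), (∀ (N : ℕ) (T_L T_R : ℝ), 0 < T_L → 0 < T_R → (Literature.MathematicalPhysics.KineticTheory.HeatConduction.pinnedChain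 ω₂ lam β γ).IsSteadyState N T_L T_R (μ N T_L T_R)) → ∀ T : ℝ, 0 < T → ∃ (ℓ : ℕ) (K : ℝ), ∀ (N : ℕ) (θ : Fin N → ℝ), (∀ i : Fin N, Filter.Tendsto (fun δ : ℝ => ((∫ x, (x.2 i) ^ 2 ∂(μ N (T + δ / 2) (T - δ / 2))) - ∫ x, (x.2 i) ^ 2 ∂(μ N T T)) / δ) (nhdsWithin 0 {(0 : ℝ)}ᶜ) (nhds (θ i))) → ∑ i : Fin N, ∑ j : Fin N, (if j.val = i.val + 1 ∧ ℓ ≤ i.val ∧ i.val + 1 + ℓ < N then max (θ j - θ i) 0 else 0) ≤ K) :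
    _root_.Summit.AtomisticToContinuum.FouriersLaw.Theses.TransferKernelPositivity.BVProfile :=
  bvProfile_of_sup_of_backflow hPB hBF

end Summit.AtomisticToContinuum.FouriersLaw.Theorems

end
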